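import Summits.QuantumFields.BalabanUV.Beta.GAN24.LatticeKernelConvolution

/-!
# `BalabanUV.Beta.GAN24.LatticeKernelConvolutionZero` — binder row G-an2-4 / (CONV-C), STENCIL slot, campaign «E3Shape» (`SKELETON-S3.md` node S3-L1,
# ANALYSIS HALF, part 2a): the product ∕ convolution theorem for pv17's lattice kernels with a SECOND FACTOR OF HALF-WIDTH ZERO —
# `C` only continuous, `2π`-periodic and bounded on the REAL zone (`StripRegular C 0 MC`: the open rectangle of half-width `0` is empty) with a
# norm-summable kernel: `Σ'_w K[A](z − w) · K[C](w) = K[A·C](z)`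

NOT IN PRINT; OUR BOOKKEEPING (engine «LK-CONV*» part 2a, CLAIMS l.4153 ∕ l.4206; row owner gan24-p1-g3 RULINGS-2 l.4221 «part 2 … one writer = you»;
unit b2b-balaban-gan24-formalise-leaf-07, gen 9).  HONEST FRAMING (cell contract, verbatim): «discharging `BetaPertH` makes Bałaban's UV stability
UNCONDITIONAL — a real constructive-QFT result; it is NOT the continuum limit and NOT the Clay problem.»  HONEST DEPENDENCY (verbatim): «continuum YM
on T⁴ ⇐ BetaPertH ∧ nine spine estimates (0/9 proved); BetaPertH ⇐ (D1) ∧ (D4) ∧ CAP+tail; G-an2-4 gates asym, D1 and NE2/3/4.»  [folklore] Fourier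
analysis on `ℤ^{d+1}`: cites nothing, mints no `def … : Prop`, asserts no statement of Bałaban's, instantiates no wall binder.  NOT summit progress.

## Why (context only; asserted nowhere below)

Part 1 (`GAN24/LatticeKernelConvolution.tsum_latticeKernel_mul`) asks BOTH symbols to be strip regular at one half-width `κ > 0` — the `C`-side
hypothesis being used only for (i) the descent dictionary (continuity, periodicity, bound: any `κ ≥ 0`) and (ii) the summability of `C`'s Fourier
coefficients (there: from exponential decay).  The PARTIAL KERNEL `p ↦ K[V(p,·)](y)` of a jointly strip-regular two-momentum symbol `V` (sibling
`GAN24/LatticeKernelConvolutionTwo`, the mixed product theorem for S3-L1's sandwich) is a parametric integral: continuous, periodic and bounded on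
the real zone, with a summable kernel by the two-momentum decay — but its holomorphy in `p` would need differentiation under the integral sign.
THIS FILE re-runs part 1's proof under exactly the weaker hypotheses: `StripRegular A κ MA`, `StripRegular C κ MC` at a common `κ ≥ 0` (so `κ = 0`
is allowed) plus `Summable ‖K[C](·)‖`.

## Contents (all [folklore])
§1 `summable_mFourierCoeff_descend_of_summable`, `hasSum_descend_of_summable`; the twisted terms `term₀` (continuity, bound, integrability, cell
   integrals, pointwise sum); `latticeKernel_mul_eq_tsum₀`; **`tsum_latticeKernel_mul₀ : Σ'_w K[A](z − w) · K[C](w) = K[A·C](z)`**,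
   **`tsum_latticeKernel_mul_sub₀`** (two-point form), `summable_latticeKernel_mul₀`, `summable_latticeKernel_mul_sub₀`.
WHAT IS NOT HERE: the partial kernel and the mixed two-momentum form (sibling `GAN24/LatticeKernelConvolutionTwo`).  NOT BetaPertH, NOT continuum, NOT Clay.
-/

noncomputable section

open Complex Set MeasureTheory Filter Topology
open Literature.MathematicalPhysics.QuantumFieldTheory.Balaban1983to89
open B4Strip (ofRealVec Strip)
open B4ContourShift (BZ latticeKernel StripRegular supNorm latticeKernel_decay ofRealVec_mem_Strip)
open B4TorusKernel (descend descendC descendC_apply mFourierCoeff_descend)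
open UnitAddTorus
open Summit.QuantumFields.BalabanUV.Beta.GAN24.LatticeKernelConvolution (cell toT cell_subset_Icc volume_cell_lt_top measurableSet_cell continuous_toT
  mFourierCoeff_eq_setIntegral_cell norm_mFourier_apply_le norm_descend_le stripRegular_nonneg)
open scoped Real

namespace Summit.QuantumFields.BalabanUV.Beta.GAN24.LatticeKernelConvolutionZero

variable {d : ℕ}

/-! ## §1 The product theorem with a real-zone second factor -/

section RealZone

variable {A C : (Fin (d + 1) → ℂ) → ℂ} {κ MA MC : ℝ}

/-- [folklore] the Fourier coefficients of the descent are the reflected lattice kernel, so norm-summability transfers. -/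
theorem summable_mFourierCoeff_descend_of_summable {G : (Fin (d + 1) → ℂ) → ℂ} {κ M : ℝ} (h : StripRegular G κ M) (hκ : 0 ≤ κ)
    (hs : Summable fun n => ‖latticeKernel G n‖) : Summable (mFourierCoeff (descendC G h hκ)) := by
  refine Summable.of_norm ?_
  have e : (fun n => ‖mFourierCoeff (descendC G h hκ) n‖) = (fun n => ‖latticeKernel G n‖) ∘ (Equiv.neg (Fin (d + 1) → ℤ)) := by
    funext n; simp only [Function.comp_apply, Equiv.neg_apply, mFourierCoeff_descend h hκ n]
  rw [e]
  exact (Equiv.neg _).summable_iff.mpr hs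

/-- [folklore] pointwise Fourier series of the descent under a summability hypothesis (half-width `κ ≥ 0` only). -/
theorem hasSum_descend_of_summable {G : (Fin (d + 1) → ℂ) → ℂ} {κ M : ℝ} (h : StripRegular G κ M) (hκ : 0 ≤ κ)
    (hs : Summable fun n => ‖latticeKernel G n‖) (t : UnitAddTorus (Fin (d + 1))) :
    HasSum (fun n => mFourierCoeff (descendC G h hκ) n * mFourier n t) (descend G t) := by
  have h1 := hasSum_mFourier_series_apply_of_summable (summable_mFourierCoeff_descend_of_summable h hκ hs) t
  simpa only [smul_eq_mul, descendC_apply] using h1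

/-- [folklore] the twisted term of the product computation, real-zone version (both symbols at one half-width `κ ≥ 0`). -/
def term₀ (hA : StripRegular A κ MA) (hC : StripRegular C κ MC) (hκ : 0 ≤ κ) (z n : Fin (d + 1) → ℤ) (x : Fin (d + 1) → ℝ) : ℂ :=
  mFourierCoeff (descendC C hC hκ) n * (mFourier z (toT x) * mFourier n (toT x) * descendC A hA hκ (toT x))

/-- [folklore] continuity of the twisted term. -/
theorem continuous_term₀ (hA : StripRegular A κ MA) (hC : StripRegular C κ MC) (hκ : 0 ≤ κ) (z n : Fin (d + 1) → ℤ) :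
    Continuous (term₀ hA hC hκ z n) := by
  unfold term₀
  refine continuous_const.mul ((Continuous.mul ?_ ?_).mul ?_)
  · exact (mFourier z).continuous.comp continuous_toT
  · exact (mFourier n).continuous.comp continuous_toT
  · exact (descendC A hA hκ).continuous.comp continuous_toT

/-- [folklore] pointwise bound of the twisted term. -/
theorem norm_term₀_le (hA : StripRegular A κ MA) (hC : StripRegular C κ MC) (hκ : 0 ≤ κ) (z n : Fin (d + 1) → ℤ) (x : Fin (d + 1) → ℝ) :
    ‖term₀ hA hC hκ z n x‖ ≤ ‖mFourierCoeff (descendC C hC hκ) n‖ * MA := by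
  unfold term₀
  rw [norm_mul, norm_mul, norm_mul]
  refine mul_le_mul_of_nonneg_left ?_ (norm_nonneg _)
  have h1 := norm_mFourier_apply_le z (toT x)
  have h2 := norm_mFourier_apply_le n (toT x)
  have h3 : ‖descendC A hA hκ (toT x)‖ ≤ MA := by rw [descendC_apply]; exact norm_descend_le hA hκ _
  have hMA : 0 ≤ MA := stripRegular_nonneg hA hκ
  calc ‖mFourier z (toT x)‖ * ‖mFourier n (toT x)‖ * ‖descendC A hA hκ (toT x)‖ ≤ 1 * 1 * MA :=
        mul_le_mul (mul_le_mul h1 h2 (norm_nonneg _) zero_le_one) h3 (norm_nonneg _) (by positivity)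
    _ = MA := by ring

/-- [folklore] integrability of the twisted term on the cell. -/
theorem integrableOn_term₀ (hA : StripRegular A κ MA) (hC : StripRegular C κ MC) (hκ : 0 ≤ κ) (z n : Fin (d + 1) → ℤ) :
    IntegrableOn (term₀ hA hC hκ z n) (cell d) volume :=
  ((continuous_term₀ hA hC hκ z n).continuousOn.integrableOn_compact isCompact_Icc).mono_set cell_subset_Icc

/-- [folklore] cell integral of the norm of a twisted term. -/
theorem integral_norm_term₀_le (hA : StripRegular A κ MA) (hC : StripRegular C κ MC) (hκ : 0 ≤ κ) (z n : Fin (d + 1) → ℤ) :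
    ∫ x in cell d, ‖term₀ hA hC hκ z n x‖ ≤ ‖mFourierCoeff (descendC C hC hκ) n‖ * MA * volume.real (cell d) := by
  have h := norm_setIntegral_le_of_norm_le_const (volume_cell_lt_top (d := d))
    (f := fun x => (‖term₀ hA hC hκ z n x‖ : ℝ)) (C := ‖mFourierCoeff (descendC C hC hκ) n‖ * MA)
    (fun x _ => by rw [Real.norm_of_nonneg (norm_nonneg _)]; exact norm_term₀_le hA hC hκ z n x)
  have h0 : 0 ≤ ∫ x in cell d, ‖term₀ hA hC hκ z n x‖ := integral_nonneg fun _ => norm_nonneg _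
  rw [Real.norm_of_nonneg h0] at h
  exact h

/-- [folklore] summability of the cell integrals of the norms, from the summability of `C`'s kernel. -/
theorem summable_integral_norm_term₀ (hA : StripRegular A κ MA) (hC : StripRegular C κ MC) (hκ : 0 ≤ κ)
    (hsC : Summable fun n => ‖latticeKernel C n‖) (z : Fin (d + 1) → ℤ) :
    Summable fun n => ∫ x in cell d, ‖term₀ hA hC hκ z n x‖ := by
  refine Summable.of_nonneg_of_le (fun n => integral_nonneg fun _ => norm_nonneg _) (fun n => integral_norm_term₀_le hA hC hκ z n) ?_
  exact (((summable_mFourierCoeff_descend_of_summable hC hκ hsC).norm).mul_right MA).mul_right _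

/-- [folklore] the pointwise sum of the twisted terms. -/
theorem tsum_term₀ (hA : StripRegular A κ MA) (hC : StripRegular C κ MC) (hκ : 0 ≤ κ)
    (hsC : Summable fun n => ‖latticeKernel C n‖) (z : Fin (d + 1) → ℤ) (x : Fin (d + 1) → ℝ) :
    ∑' n, term₀ hA hC hκ z n x = mFourier z (toT x) * (descend A (toT x) * descend C (toT x)) := by
  have e : ∀ n, term₀ hA hC hκ z n x =
      (mFourier z (toT x) * descend A (toT x)) * (mFourierCoeff (descendC C hC hκ) n * mFourier n (toT x)) := by
    intro n; unfold term₀; rw [descendC_apply]; ring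
  simp_rw [e]
  rw [tsum_mul_left, (hasSum_descend_of_summable hC hκ hsC (toT x)).tsum_eq]
  ring

/-- [folklore] the cell integral of one twisted term. -/
theorem integral_term₀ (hA : StripRegular A κ MA) (hC : StripRegular C κ MC) (hκ : 0 ≤ κ) (z n : Fin (d + 1) → ℤ) :
    ∫ x in cell d, term₀ hA hC hκ z n x =
      mFourierCoeff (descendC C hC hκ) n * mFourierCoeff (descendC A hA hκ) (-(z + n)) := by
  unfold term₀
  rw [integral_const_mul, mFourierCoeff_eq_setIntegral_cell (descendC A hA hκ) (-(z + n)), neg_neg]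
  congr 1
  refine setIntegral_congr_fun measurableSet_cell fun x _ => ?_
  rw [mFourier_add]

/-- [folklore] coefficient form of the product theorem, real-zone second factor. -/
theorem latticeKernel_mul_eq_tsum₀ (hA : StripRegular A κ MA) (hC : StripRegular C κ MC) (hκ : 0 ≤ κ)
    (hsC : Summable fun n => ‖latticeKernel C n‖) (z : Fin (d + 1) → ℤ) :
    latticeKernel (fun p => A p * C p) z = ∑' n, latticeKernel C (-n) * latticeKernel A (z + n) := by
  have hAC : StripRegular (fun p => A p * C p) κ (MA * MC) := hA.mul hC (stripRegular_nonneg hA hκ)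
  have h1 : latticeKernel (fun p => A p * C p) z = ∫ x in cell d, mFourier z (toT x) * (descend A (toT x) * descend C (toT x)) := by
    have e := mFourierCoeff_descend hAC hκ (-z)
    rw [neg_neg] at e
    rw [← e, mFourierCoeff_eq_setIntegral_cell, neg_neg]
    rfl
  have h2 : ∫ x in cell d, mFourier z (toT x) * (descend A (toT x) * descend C (toT x)) = ∫ x in cell d, ∑' n, term₀ hA hC hκ z n x :=
    setIntegral_congr_fun measurableSet_cell fun x _ => (tsum_term₀ hA hC hκ hsC z x).symm
  have h3 : ∫ x in cell d, ∑' n, term₀ hA hC hκ z n x = ∑' n, ∫ x in cell d, term₀ hA hC hκ z n x :=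
    (integral_tsum_of_summable_integral_norm (fun n => integrableOn_term₀ hA hC hκ z n) (summable_integral_norm_term₀ hA hC hκ hsC z)).symm
  rw [h1, h2, h3]
  refine tsum_congr fun n => ?_
  rw [integral_term₀, mFourierCoeff_descend hC hκ, mFourierCoeff_descend hA hκ, neg_neg]

/-- [folklore] absolute summability of the convolution summand (bounded × norm-summable). -/
theorem summable_latticeKernel_mul₀ (hA : StripRegular A κ MA) (hκ : 0 ≤ κ) (hsC : Summable fun n => ‖latticeKernel C n‖)
    (z : Fin (d + 1) → ℤ) : Summable fun w => latticeKernel A (z - w) * latticeKernel C w := by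
  refine Summable.of_norm_bounded (hsC.mul_left MA) fun w => ?_
  rw [norm_mul]
  refine mul_le_mul_of_nonneg_right ?_ (norm_nonneg _)
  refine (latticeKernel_decay hA hκ (z - w)).trans ?_
  have hMA : 0 ≤ MA := stripRegular_nonneg hA hκ
  have : Real.exp (-(κ * supNorm (z - w))) ≤ 1 :=
    Real.exp_le_one_iff.mpr (by nlinarith [B4ContourShift.supNorm_nonneg (z - w), hκ])
  nlinarith

/-- [folklore] **THE PRODUCT THEOREM WITH A REAL-ZONE SECOND FACTOR**: `A` strip regular (`κ ≥ 0`), `C` strip regular at the SAME `κ` (for `κ = 0`: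
continuous, periodic and bounded on the real zone — no holomorphy) with norm-summable kernel ⇒ `Σ'_w K[A](z − w) · K[C](w) = K[A·C](z)`. -/
theorem tsum_latticeKernel_mul₀ (hA : StripRegular A κ MA) (hC : StripRegular C κ MC) (hκ : 0 ≤ κ)
    (hsC : Summable fun n => ‖latticeKernel C n‖) (z : Fin (d + 1) → ℤ) :
    ∑' w, latticeKernel A (z - w) * latticeKernel C w = latticeKernel (fun p => A p * C p) z := by
  rw [latticeKernel_mul_eq_tsum₀ hA hC hκ hsC z, ← (Equiv.neg (Fin (d + 1) → ℤ)).tsum_eq]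
  refine tsum_congr fun w => ?_
  show latticeKernel A (z - -w) * latticeKernel C (-w) = latticeKernel C (-w) * latticeKernel A (z + w)
  rw [sub_neg_eq_add, mul_comm]

/-- [folklore] two-point form. -/
theorem tsum_latticeKernel_mul_sub₀ (hA : StripRegular A κ MA) (hC : StripRegular C κ MC) (hκ : 0 ≤ κ)
    (hsC : Summable fun n => ‖latticeKernel C n‖) (x y : Fin (d + 1) → ℤ) :
    ∑' w, latticeKernel A (x - w) * latticeKernel C (w - y) = latticeKernel (fun p => A p * C p) (x - y) := by
  rw [← tsum_latticeKernel_mul₀ hA hC hκ hsC (x - y)]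
  show ∑' w, latticeKernel A (x - w) * latticeKernel C (w - y) = ∑' u, latticeKernel A (x - y - u) * latticeKernel C u
  rw [← (Equiv.addRight y).tsum_eq]
  refine tsum_congr fun w => ?_
  show latticeKernel A (x - (w + y)) * latticeKernel C (w + y - y) = latticeKernel A (x - y - w) * latticeKernel C w
  rw [add_sub_cancel_right]
  congr 2
  abel

/-- [folklore] summability of the two-point summand. -/
theorem summable_latticeKernel_mul_sub₀ (hA : StripRegular A κ MA) (hκ : 0 ≤ κ) (hsC : Summable fun n => ‖latticeKernel C n‖)
    (x y : Fin (d + 1) → ℤ) : Summable fun w => latticeKernel A (x - w) * latticeKernel C (w - y) := by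
  have h := (Equiv.subRight y).summable_iff.mpr (summable_latticeKernel_mul₀ hA hκ hsC (x - y))
  refine h.congr fun w => ?_
  show latticeKernel A (x - y - (w - y)) * latticeKernel C (w - y) = latticeKernel A (x - w) * latticeKernel C (w - y)
  congr 2
  abel

end RealZone

end Summit.QuantumFields.BalabanUV.Beta.GAN24.LatticeKernelConvolutionZero

end
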